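import Mathlib
import Summits.NavierStokesRegularity.NavierStokesRegularity.Theorems.TypeIQuarterGateScarEnvelopeTypeIZoomDictionaryDefs
import Summits.NavierStokesRegularity.NavierStokesRegularity.Theorems.TypeIQuarterGateScarEnvelopeTypeIZoomDictionaryLemmas
import Summits.NavierStokesRegularity.NavierStokesRegularity.Theorems.TypeIQuarterGateScarEnvelopeTypeIZoomDictionaryPersistence

/-!
# Part F: the dictionary at every small satellite

Part F of the plate: reading the dictionary at EVERY small satellite by rescaling tangent flows (`RegPt`, `regPt_of_zoomIn`, …).

PROVENANCE: declaration texts VERBATIM from the HOME plates of the instrument seat nsreg-p3 (g24/g25, cell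
`pub/ns-regularity-ideate`): `round-31/Tangent31prep.lean` v5 (sha16 `e5b8668e3a090216`; = ROUND-30 plate v10 + Part K) and,
for Part L, `round-32/Tangent32prep.lean` v6 (sha16 `6123f27718636121`);
the author cannot write under `Theorems/` (`perm.theorems-prover-only`); landed by the
LEAD-lineage prover ns-sz-p1 g5 on director-ns DIRECTOR-NS #218 (2), split into ≤ 400-line modules (the
plate's `def`s gathered in `TypeIQuarterGateScarEnvelopeTypeIZoomDictionaryDefs`), namespace
`Summit.NavierStokesRegularity.NavierStokesRegularity.Cruxes.ScarEnvelopeTypeI.ZoomDictionary` (the plate's `NsregP3.R30P`), `E3` spelled out, one-line docstrings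
added where the plate had none.  `--supports stmt-NavierStokesRegularity-23843 --as helper`.

HONEST FRAMING: dictionary / census TOOLING for the crux `TypeIQuarterGate.ScarEnvelopeTypeI` (item 23843):
equivalences and normal forms, kernel-checked; NO open statement is proved — 23843, its parent
`QuarterLawTypeI` (23726), the route and Navier–Stokes regularity are OPEN; hard core evaded: none.
-/

-- the summit-side namespace repeats a component by design (single-conjunct summit, D-0017)
set_option linter.dupNamespace false

open MeasureTheory Set Metric Filter Topology
open scoped ENNReal

namespace Summit.NavierStokesRegularity.NavierStokesRegularity.Cruxes.ScarEnvelopeTypeI.ZoomDictionary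

variable {u : ℝ → (EuclideanSpace ℝ (Fin 3)) → (EuclideanSpace ℝ (Fin 3))} {a : (EuclideanSpace ℝ (Fin 3))} {ν T : ℝ}

section UnitNormalisation

open Literature.Analysis.FluidPDE
variable {u : ℝ → (EuclideanSpace ℝ (Fin 3)) → (EuclideanSpace ℝ (Fin 3))} {p : ℝ → (EuclideanSpace ℝ (Fin 3)) → ℝ} {a : (EuclideanSpace ℝ (Fin 3))} {T : ℝ}

/-! ### Part F — reading the dictionary at EVERY small satellite (rescaling tangent flows)

The right-hand side of the dictionary tests tangent flows only at the final-time points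
`(0, c₀⁻¹ y)`, `1 ≤ |y| ≤ e`.  Zooming a tangent flow IN by a factor `c ≤ 1` gives the tangent
flow along the scale sequence `c L` (`tangentU_zoomIn`), so the right-hand side is equivalent to
«every tangent flow is (essentially) regular at every final-time point `y'` with
`0 < |y'| ≤ e / c₀`» (`noSatellite_iff_small`). -/

/-- Zoomed pressures at the product scale. -/
theorem zoomP_mul (p : ℝ → (EuclideanSpace ℝ (Fin 3)) → ℝ) (a : (EuclideanSpace ℝ (Fin 3))) (T ℓ c s : ℝ) (x : (EuclideanSpace ℝ (Fin 3))) :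
    zoomP p a T (c * ℓ) s x = c ^ 2 * zoomP p a T ℓ (c ^ 2 * s) (c • x) := by
  have h1 : T + (c * ℓ) ^ 2 * s = T + ℓ ^ 2 * (c ^ 2 * s) := by ring
  have h2 : a + (c * ℓ) • x = a + ℓ • (c • x) := by rw [smul_smul, mul_comm]
  unfold zoomP
  rw [h1, h2]
  ring

/-- Zoom at scale `cℓ` = parabolic rescaling by `c` of the zoom at scale `ℓ`. [folklore] -/
theorem zoom_scale_eq (c ℓ : ℝ) :
    zoom u a T (c * ℓ) = c • stPull (c ^ 2) c (0 : ℝ) (0 : (EuclideanSpace ℝ (Fin 3))) (zoom u a T ℓ) := by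
  funext s y
  rw [zoom_mul, smul_stPull_apply, zero_add, zero_add]

/-- Pressure zoom at scale `cℓ` = parabolic rescaling by `c` (weight `c²`) of the pressure zoom at scale `ℓ`. [folklore] -/
theorem zoomP_scale_eq (c ℓ : ℝ) :
    zoomP p a T (c * ℓ) = c ^ 2 • stPull (c ^ 2) c (0 : ℝ) (0 : (EuclideanSpace ℝ (Fin 3))) (zoomP p a T ℓ) := by
  funext s y
  rw [zoomP_mul, smul_stPull_apply, zero_add, zero_add, smul_eq_mul]

/-- **Zooming a tangent flow in.** If `ū` is a tangent flow along the scales `L`, then for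
`0 < c ≤ 1` the zoomed field `c ū(c² s, c y)` is a tangent flow along the scales `c L`. -/
theorem tangentU_zoomIn {c : ℝ} (hc0 : 0 < c) (hc1 : c ≤ 1) {L : ℕ → ℝ} {ū : ℝ → (EuclideanSpace ℝ (Fin 3)) → (EuclideanSpace ℝ (Fin 3))}
    (h : TangentU u p a T L ū) :
    TangentU u p a T (fun k => c * L k) (c • stPull (c ^ 2) c (0 : ℝ) (0 : (EuclideanSpace ℝ (Fin 3))) ū) := by
  obtain ⟨hpos, hlim, pbar, hR⟩ := h
  refine ⟨fun k => mul_pos hc0 (hpos k), ?_, c ^ 2 • stPull (c ^ 2) c (0 : ℝ) (0 : (EuclideanSpace ℝ (Fin 3))) pbar,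
    ?_⟩
  · simpa using hlim.const_mul c
  intro R hR'
  have hcR : c * R ∈ Ioo (0 : ℝ) 1 :=
    ⟨mul_pos hc0 hR'.1, (mul_le_of_le_one_left hR'.1.le hc1).trans_lt hR'.2⟩
  obtain ⟨hIB, hM, hconv, hweak⟩ := hR (c * R) hcR
  have hdiv : c * R / c = R := mul_div_cancel_left₀ R hc0.ne'
  refine ⟨?_, ?_, ?_, ?_⟩
  · have h1 := hIB.zoomOut hc0
    rwa [hdiv] at h1
  · have h1 := (memLp_comp_zoom hc0 (by norm_num) (by norm_num) hM).const_smul c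
    rw [hdiv] at h1
    have e : Function.uncurry (c • stPull (c ^ 2) c (0 : ℝ) (0 : (EuclideanSpace ℝ (Fin 3))) ū) =
        c • (Function.uncurry ū ∘ stAffine (c ^ 2) c (0 : ℝ) (0 : (EuclideanSpace ℝ (Fin 3)))) := by
      funext z; rfl
    rw [e]
    exact h1
  · have e : ∀ k, Function.uncurry (zoom u a T (c * L k)) -
        Function.uncurry (c • stPull (c ^ 2) c (0 : ℝ) (0 : (EuclideanSpace ℝ (Fin 3))) ū) =
        Function.uncurry (c • stPull (c ^ 2) c (0 : ℝ) (0 : (EuclideanSpace ℝ (Fin 3))) (zoom u a T (L k) - ū)) := by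
      intro k
      funext z
      obtain ⟨s, y⟩ := z
      simp only [Pi.sub_apply, Function.uncurry_apply_pair, smul_stPull_apply, zoom_mul, zero_add,
        smul_sub]
    have hnorm : ∀ k, eLpNorm (Function.uncurry (zoom u a T (c * L k)) -
        Function.uncurry (c • stPull (c ^ 2) c (0 : ℝ) (0 : (EuclideanSpace ℝ (Fin 3))) ū)) 3
          (volume.restrict (parabolicCylinder R (0 : ℝ × (EuclideanSpace ℝ (Fin 3))))) =
        ‖c‖ₑ * (ENNReal.ofReal (c ^ 2 * c ^ 3)⁻¹) ^ (1 / (3 : ℝ≥0∞).toReal) *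
          eLpNorm (Function.uncurry (zoom u a T (L k)) - Function.uncurry ū) 3
            (volume.restrict (parabolicCylinder (c * R) (0 : ℝ × (EuclideanSpace ℝ (Fin 3))))) := by
      intro k
      have h1 := eLpNorm_uncurry_zoom hc0 c (zoom u a T (L k) - ū) (c * R)
        (q := (3 : ℝ≥0∞)) (by norm_num) (by norm_num)
      rw [hdiv] at h1
      rw [e k, h1]
      rfl
    simp_rw [hnorm]
    have hcne : ‖c‖ₑ ≠ ⊤ := enorm_ne_top
    have hK : ‖c‖ₑ * (ENNReal.ofReal (c ^ 2 * c ^ 3)⁻¹) ^ (1 / (3 : ℝ≥0∞).toReal) ≠ ⊤ :=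
      ENNReal.mul_ne_top hcne
        (ENNReal.rpow_ne_top_of_nonneg (by positivity) ENNReal.ofReal_ne_top)
    have h2 := ENNReal.Tendsto.const_mul hconv (Or.inr hK)
    simpa using h2
  · intro g hg
    set g' : ℝ × (EuclideanSpace ℝ (Fin 3)) → ℝ := fun w => g (stAffine (c⁻¹ ^ 2) c⁻¹ 0 (-(c⁻¹ • (0 : (EuclideanSpace ℝ (Fin 3))))) w)
      with hg'def
    have hg' : MemLp g' 3 (volume.restrict (parabolicCylinder (c * R) (0 : ℝ × (EuclideanSpace ℝ (Fin 3))))) := by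
      have h1 := memLp_comp_zoomAt_inv hc0 (0 : (EuclideanSpace ℝ (Fin 3))) hg
      rwa [Prod.mk_zero_zero] at h1
    have hgg : ∀ w, g w = g' (stAffine (c ^ 2) c 0 0 w) := fun w =>
      (congrArg g (stAffine_inv_comp hc0.ne' 0 w)).symm
    have key : ∀ π : ℝ → (EuclideanSpace ℝ (Fin 3)) → ℝ,
        ∫ w in parabolicCylinder R (0 : ℝ × (EuclideanSpace ℝ (Fin 3))),
            (c ^ 2 • stPull (c ^ 2) c (0 : ℝ) (0 : (EuclideanSpace ℝ (Fin 3))) π) w.1 w.2 * g w =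
          c ^ 2 * (c ^ 2 * c ^ 3)⁻¹ *
            ∫ w in parabolicCylinder (c * R) (0 : ℝ × (EuclideanSpace ℝ (Fin 3))), π w.1 w.2 * g' w := by
      intro π
      have h1 := setIntegral_zoom_pressure_mul hc0 (c ^ 2) π g' (c * R)
      rw [hdiv] at h1
      rw [← h1]
      refine setIntegral_congr_fun (isOpen_parabolicCylinder _ _).measurableSet fun w _ => ?_
      rw [hgg w]
    simp_rw [zoomP_scale_eq, key]
    exact (hweak g' hg').const_mul _

/-- `RegU ū y` is `RegPt ū (c₀⁻¹ • y)` (definitional). [folklore] -/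
theorem regU_iff_regPt {ū : ℝ → (EuclideanSpace ℝ (Fin 3)) → (EuclideanSpace ℝ (Fin 3))} {y : (EuclideanSpace ℝ (Fin 3))} : RegU ū y ↔ RegPt ū (c₀⁻¹ • y) := Iff.rfl

/-- Regularity transports back along the zoom: if `c ū(c² s, c y)` is regular at `(0, c⁻¹ y')`
then `ū` is regular at `(0, y')`. -/
theorem regPt_of_zoomIn {c : ℝ} (hc0 : 0 < c) {ū : ℝ → (EuclideanSpace ℝ (Fin 3)) → (EuclideanSpace ℝ (Fin 3))} {y' : (EuclideanSpace ℝ (Fin 3))}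
    (h : RegPt (c • stPull (c ^ 2) c (0 : ℝ) (0 : (EuclideanSpace ℝ (Fin 3))) ū) (c⁻¹ • y')) : RegPt ū y' := by
  obtain ⟨r, hr, M, hM⟩ := h
  refine ⟨c * r, mul_pos hc0 hr, c⁻¹ * M, ?_⟩
  have hpre : stAffine (c ^ 2) c 0 0 ⁻¹' parabolicCylinder (c * r) ((0 : ℝ), y') =
      parabolicCylinder r ((0 : ℝ), c⁻¹ • y') := by
    have h1 := LocalTypeIScaling.stAffine_preimage_parabolicCylinder hc0 (0 : ℝ) (0 : (EuclideanSpace ℝ (Fin 3))) r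
      ((0 : ℝ), c⁻¹ • y')
    have e : stAffine (c ^ 2) c 0 0 ((0 : ℝ), c⁻¹ • y') = ((0 : ℝ), y') := by
      rw [stAffine_apply, mul_zero, zero_add, zero_add, smul_smul, mul_inv_cancel₀ hc0.ne',
        one_smul]
    rwa [e] at h1
  apply ae_restrict_of_ae_restrict_preimage_stAffine (pow_pos hc0 2) hc0 (0 : ℝ) (0 : (EuclideanSpace ℝ (Fin 3)))
  rw [hpre]
  filter_upwards [hM] with z hz
  rw [smul_stPull_apply, norm_smul, Real.norm_of_nonneg hc0.le, zero_add, zero_add] at hz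
  obtain ⟨s, y⟩ := z
  rw [stAffine_apply]
  dsimp only
  rw [zero_add, zero_add, le_inv_mul_iff₀ hc0]
  exact hz

/-- **No small satellites.** The right-hand side of the dictionary excludes satellites at every
final-time point `y'` with `0 < |y'| ≤ e / c₀`, for every tangent flow. -/
theorem regPt_of_noSatellite
    (h : ∀ L ū, TangentU u p a T L ū → ∀ y ∈ unitAnn, RegU ū y)
    {L : ℕ → ℝ} {ū : ℝ → (EuclideanSpace ℝ (Fin 3)) → (EuclideanSpace ℝ (Fin 3))} (ht : TangentU u p a T L ū) {y' : (EuclideanSpace ℝ (Fin 3))} (hy0 : y' ≠ 0)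
    (hy1 : ‖y'‖ ≤ Real.exp 1 / c₀) : RegPt ū y' := by
  have hc₀ : 0 < c₀ := c₀_pos
  have hn : 0 < ‖y'‖ := norm_pos_iff.2 hy0
  have he : 0 < Real.exp 1 := Real.exp_pos 1
  set c : ℝ := c₀ * ‖y'‖ / Real.exp 1 with hc
  have hc0 : 0 < c := by positivity
  have hc1 : c ≤ 1 := by
    rw [hc, div_le_one he]
    calc c₀ * ‖y'‖ ≤ c₀ * (Real.exp 1 / c₀) := mul_le_mul_of_nonneg_left hy1 hc₀.le
      _ = Real.exp 1 := mul_div_cancel₀ _ hc₀.ne'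
  set y : (EuclideanSpace ℝ (Fin 3)) := (Real.exp 1 / ‖y'‖) • y' with hy
  have hyA : y ∈ unitAnn := by
    show ‖y‖ ∈ Icc 1 (Real.exp 1)
    rw [hy, norm_smul, Real.norm_of_nonneg (by positivity), div_mul_cancel₀ _ hn.ne']
    exact ⟨Real.one_le_exp zero_le_one, le_rfl⟩
  have hreg := h _ _ (tangentU_zoomIn hc0 hc1 ht) y hyA
  have e : c₀⁻¹ • y = c⁻¹ • y' := by
    rw [hy, smul_smul, hc]
    congr 1
    field_simp
  refine regPt_of_zoomIn hc0 ?_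
  rw [← e]
  exact hreg

/-- The right-hand side of the dictionary, read at every small satellite. -/
theorem noSatellite_iff_small :
    (∀ L ū, TangentU u p a T L ū → ∀ y ∈ unitAnn, RegU ū y) ↔
      ∀ L ū, TangentU u p a T L ū → ∀ y' : (EuclideanSpace ℝ (Fin 3)), y' ≠ 0 → ‖y'‖ ≤ Real.exp 1 / c₀ → RegPt ū y' := by
  refine ⟨fun h L ū ht y' hy0 hy1 => regPt_of_noSatellite h ht hy0 hy1, fun h L ū ht y hy => ?_⟩
  have hc₀ : 0 < c₀ := c₀_pos
  have hy1 : (1 : ℝ) ≤ ‖y‖ := hy.1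
  refine h L ū ht (c₀⁻¹ • y) ?_ ?_
  · rw [smul_ne_zero_iff]
    exact ⟨inv_ne_zero hc₀.ne', fun h0 => by rw [h0, norm_zero] at hy1; exact absurd hy1 (by norm_num)⟩
  · rw [norm_smul, Real.norm_of_nonneg (inv_nonneg.2 hc₀.le), inv_mul_eq_div]
    exact div_le_div_of_nonneg_right hy.2 hc₀.le

/-- **SD, read at every small satellite** (ν = 1): the annular cubic slice budget at `a` holds
iff every tangent flow at `(a, T)` is essentially bounded near every final-time point `(0, y')`,
`0 < |y'| ≤ e / c₀`. -/
theorem budgetAt_iff_noSmallSatellite (hT : 0 < T)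
    (hcont : ContinuousOn (Function.uncurry u) (Ioo 0 T ×ˢ univ))
    (hTI : IsTypeIBlowup u T) (hZ : ZoomsInBall u p a T) (hB : ZoomsBddU u p a T) :
    BudgetAt 1 T u a ↔ ∀ L ū, TangentU u p a T L ū →
      ∀ y' : (EuclideanSpace ℝ (Fin 3)), y' ≠ 0 → ‖y'‖ ≤ Real.exp 1 / c₀ → RegPt ū y' :=
  (dictionaryU' hT hcont hTI hZ hB).trans noSatellite_iff_small

-- negative control (must FAIL if uncommented): the outer bound cannot be dropped for free
-- example (h : ∀ L ū, TangentU u p a T L ū → ∀ y ∈ unitAnn, RegU ū y) {L ū}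
--     (ht : TangentU u p a T L ū) {y' : E3} (hy0 : y' ≠ 0) : RegPt ū y' :=
--   regPt_of_noSatellite h ht hy0 le_rfl

end UnitNormalisation

end Summit.NavierStokesRegularity.NavierStokesRegularity.Cruxes.ScarEnvelopeTypeI.ZoomDictionary
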